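import Mathlib
import HarnessLib

/-!
# Integrality of `f(x)` from integrality of `f(x(t))` for `x(t) ∈ t + (t²/M)ℤ⟦t/M⟧` (CDT §2.1)

`Literature/RingTheory/PowerSeries/DenominatorTypeInversion.lean`. Everything here is PROVED (no
definition, no named fact). In the proof of their auxiliary construction (Lemma 2.1.1),
F. Calegari, V. Dimitrov, Y. Tang, *The unbounded denominators conjecture* (J. Amer. Math. Soc.
**38** (2025), 627–702; arXiv:2109.09040), §2.1, having shown `x(t) ∈ t + (t²/M) ℤ⟦t/M⟧`,
continue: "Now the inverse series also has `t(x) ∈ x + (x²/M) ℤ⟦x/M⟧`, and so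
`f_i(x(t)) ∈ ℤ⟦t⟧` entails `f_i(x) ∈ ℤ⟦x/M⟧` for all `i = 1, …, m`." We formalize this with
Mathlib's substitution of power series (`PowerSeries.subst`) and compositional inverse
(`PowerSeries.substInvOfIsUnit`): a series of the shape `x(t) = M · w(t/M)` with
`w = T + T²(⋯) ∈ ℤ⟦T⟧` — that is, `x ∈ t + (t²/M)ℤ⟦t/M⟧` — has a compositional inverse of the
same shape `t(x) = M · v(x/M)`, `v = w⁻¹ ∈ ℤ⟦T⟧` (`subst_inverse_of_denominatorType`), and
consequently `f(x(t)) ∈ ℤ⟦t⟧` implies `f(M x) ∈ ℤ⟦x⟧`, i.e. `f ∈ ℤ⟦x/M⟧`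
(`rescale_mem_range_of_subst_mem_range`).

## References

* [CalegariDimitrovTang2025] F. Calegari, V. Dimitrov, Y. Tang, The unbounded denominators
  conjecture, J. Amer. Math. Soc. 38 (2025), no. 3, 627–702, §2.1, proof of Lemma 2.1.1;
  arXiv:2109.09040.
-/

noncomputable section

open PowerSeries

namespace Literature.RingTheory.PowerSeries

/-! ### 1. Small substitution identities -/

section general

variable {R S : Type*} [CommRing R] [CommRing S]

/-- `PowerSeries.map` commutes with substitution (Mathlib's `PowerSeries.map_subst`, restated for
a one-variable substituend). [folklore] -/
theorem map_subst' {a : PowerSeries R} (ha : HasSubst a) (h : R →+* S) (f : PowerSeries R) :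
    PowerSeries.map h (f.subst a) = (PowerSeries.map h f).subst (PowerSeries.map h a) :=
  PowerSeries.map_subst ha (h := h) f

/-- Substituting into `r • X`: `(r • X)(a) = r • a`. [folklore] -/
theorem smul_X_subst (r : R) {a : PowerSeries R} (ha : HasSubst a) :
    (r • (X : PowerSeries R)).subst a = r • a := by
  rw [PowerSeries.subst_smul ha, PowerSeries.subst_X ha]

/-- `(r • X)(0) = 0`. [folklore] -/
theorem constantCoeff_smul_X (r : R) : constantCoeff (r • (X : PowerSeries R)) = 0 := by
  rw [smul_eq_C_mul, map_mul, constantCoeff_X, mul_zero]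

/-- A substituend of the form `r • a` with `a(0) = 0` is admissible. [folklore] -/
theorem hasSubst_smul {a : PowerSeries R} (ha : constantCoeff a = 0) (r : R) :
    HasSubst (r • a) :=
  HasSubst.of_constantCoeff_zero' (by rw [smul_eq_C_mul, map_mul, ha, mul_zero])

end general

/-! ### 2. Series of denominator type `M`: `x(t) = M · w(t/M)`, `w ∈ T + T²ℤ⟦T⟧` -/

variable {M : ℕ}

/-- For `x(t) = M · w(t/M)` with `w = T + T²(⋯) ∈ ℤ⟦T⟧` and `v = w⁻¹` its compositional inverse
(`∈ ℤ⟦T⟧`, Mathlib's `PowerSeries.substInvOfIsUnit`), the series `y(x) = M · v(x/M)` is a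
compositional right inverse of `x`: `x(y(X)) = X`. In CDT's words: "the inverse series also has
`t(x) ∈ x + (x²/M) ℤ⟦x/M⟧`". [cite: CalegariDimitrovTang2025, §2.1, proof of Lemma 2.1.1] -/
theorem subst_inverse_of_denominatorType (hM : M ≠ 0) {w : PowerSeries ℤ}
    (hw0 : constantCoeff w = 0) (hw1 : IsUnit (coeff 1 w)) :
    PowerSeries.subst
      ((M : ℚ) • (PowerSeries.subst ((M : ℚ)⁻¹ • (X : PowerSeries ℚ))
        (PowerSeries.map (Int.castRingHom ℚ) (w.substInvOfIsUnit hw1)) : PowerSeries ℚ))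
      ((M : ℚ) • (PowerSeries.subst ((M : ℚ)⁻¹ • (X : PowerSeries ℚ))
        (PowerSeries.map (Int.castRingHom ℚ) w) : PowerSeries ℚ)) = (X : PowerSeries ℚ) := by
  have hMq : (M : ℚ) ≠ 0 := by exact_mod_cast hM
  set v := w.substInvOfIsUnit hw1 with hv
  set XM : PowerSeries ℚ := (M : ℚ)⁻¹ • (X : PowerSeries ℚ) with hXMdef
  set vq : PowerSeries ℚ := PowerSeries.map (Int.castRingHom ℚ) v with hvq
  set wq : PowerSeries ℚ := PowerSeries.map (Int.castRingHom ℚ) w with hwq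
  set y : PowerSeries ℚ := (M : ℚ) • (PowerSeries.subst XM vq : PowerSeries ℚ) with hy
  have hv0 : constantCoeff v = 0 := constantCoeff_substInvOfIsUnit w hw1
  have hwv : PowerSeries.subst v w = X := subst_substInvOfIsUnit_right w hw0 hw1
  -- admissibility of the various substituends
  have hXM : HasSubst XM := HasSubst.smul_X' _
  have hvq0 : constantCoeff vq = 0 := by
    rw [hvq, ← coeff_zero_eq_constantCoeff_apply, coeff_map, coeff_zero_eq_constantCoeff_apply,
      hv0, map_zero]
  have hvM0 : constantCoeff (PowerSeries.subst XM vq : PowerSeries ℚ) = 0 :=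
    constantCoeff_subst_eq_zero (constantCoeff_smul_X _) _ hvq0
  have hys : HasSubst y := hasSubst_smul hvM0 _
  have hvs : HasSubst vq := HasSubst.of_constantCoeff_zero' hvq0
  -- `(X/M)(y) = v_ℚ(X/M)`
  have h1 : (PowerSeries.subst y XM : PowerSeries ℚ) = PowerSeries.subst XM vq := by
    rw [hXMdef, smul_X_subst _ hys, hy, smul_smul, inv_mul_cancel₀ hMq, one_smul]
  -- `w_ℚ (v_ℚ) = X`
  have h2 : (PowerSeries.subst vq wq : PowerSeries ℚ) = X := by
    rw [hvq, hwq, ← map_subst' (HasSubst.of_constantCoeff_zero' hv0), hwv, map_X]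
  calc (PowerSeries.subst y ((M : ℚ) • (PowerSeries.subst XM wq : PowerSeries ℚ)) : PowerSeries ℚ)
      = (M : ℚ) • (PowerSeries.subst y (PowerSeries.subst XM wq : PowerSeries ℚ) : PowerSeries ℚ) := by
        rw [PowerSeries.subst_smul hys]
    _ = (M : ℚ) • (PowerSeries.subst (PowerSeries.subst y XM : PowerSeries ℚ) wq : PowerSeries ℚ) := by
        rw [subst_comp_subst_apply hXM hys]
    _ = (M : ℚ) • (PowerSeries.subst XM (PowerSeries.subst vq wq : PowerSeries ℚ) : PowerSeries ℚ) := by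
        rw [h1, subst_comp_subst_apply hvs hXM]
    _ = X := by
        rw [h2, PowerSeries.subst_X hXM, hXMdef, smul_smul, mul_inv_cancel₀ hMq, one_smul]

/-- **`f(x(t)) ∈ ℤ⟦t⟧` entails `f(x) ∈ ℤ⟦x/M⟧`** (CDT §2.1, proof of Lemma 2.1.1): if
`x(t) = M · w(t/M)` with `w = T + T²(⋯) ∈ ℤ⟦T⟧` (so that `x ∈ t + (t²/M)ℤ⟦t/M⟧`) and
`f(x(t)) ∈ ℤ⟦t⟧`, then `f(M X) ∈ ℤ⟦X⟧`: the rescaling of `f` by `M` has integer coefficients.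
Indeed `f = f(x(y))` with `y = M v(X/M)` as above, and `((f ∘ x) ∘ y)(M X) = (f ∘ x)(M v(X))`.
[cite: CalegariDimitrovTang2025, §2.1, proof of Lemma 2.1.1] -/
theorem rescale_mem_range_of_subst_mem_range (hM : M ≠ 0) {w : PowerSeries ℤ}
    (hw0 : constantCoeff w = 0) (hw1 : IsUnit (coeff 1 w)) {f : PowerSeries ℚ} {G : PowerSeries ℤ}
    (hfG : PowerSeries.subst
      ((M : ℚ) • (PowerSeries.subst ((M : ℚ)⁻¹ • (X : PowerSeries ℚ))
        (PowerSeries.map (Int.castRingHom ℚ) w) : PowerSeries ℚ)) f =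
      PowerSeries.map (Int.castRingHom ℚ) G) :
    ∃ F : PowerSeries ℤ, PowerSeries.map (Int.castRingHom ℚ) F = rescale (M : ℚ) f := by
  have hMq : (M : ℚ) ≠ 0 := by exact_mod_cast hM
  set v := w.substInvOfIsUnit hw1 with hv
  set XM : PowerSeries ℚ := (M : ℚ)⁻¹ • (X : PowerSeries ℚ) with hXMdef
  set vq : PowerSeries ℚ := PowerSeries.map (Int.castRingHom ℚ) v with hvq
  set wq : PowerSeries ℚ := PowerSeries.map (Int.castRingHom ℚ) w with hwq
  set x : PowerSeries ℚ := (M : ℚ) • (PowerSeries.subst XM wq : PowerSeries ℚ) with hx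
  set y : PowerSeries ℚ := (M : ℚ) • (PowerSeries.subst XM vq : PowerSeries ℚ) with hy
  have hxy : (PowerSeries.subst y x : PowerSeries ℚ) = X := subst_inverse_of_denominatorType hM hw0 hw1
  have hv0 : constantCoeff v = 0 := constantCoeff_substInvOfIsUnit w hw1
  -- admissibility
  have hXM : HasSubst XM := HasSubst.smul_X' _
  have hMX : HasSubst ((M : ℚ) • (X : PowerSeries ℚ)) := HasSubst.smul_X' _
  have hvq0 : constantCoeff vq = 0 := by
    rw [hvq, ← coeff_zero_eq_constantCoeff_apply, coeff_map, coeff_zero_eq_constantCoeff_apply,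
      hv0, map_zero]
  have hwq0 : constantCoeff wq = 0 := by
    rw [hwq, ← coeff_zero_eq_constantCoeff_apply, coeff_map, coeff_zero_eq_constantCoeff_apply,
      hw0, map_zero]
  have hys : HasSubst y :=
    hasSubst_smul (constantCoeff_subst_eq_zero (constantCoeff_smul_X _) _ hvq0) _
  have hxs : HasSubst x :=
    hasSubst_smul (constantCoeff_subst_eq_zero (constantCoeff_smul_X _) _ hwq0) _
  have hMv : HasSubst (C (M : ℤ) * v) :=
    HasSubst.of_constantCoeff_zero' (by rw [map_mul, hv0, mul_zero])
  -- `f = (f ∘ x)(y) = G_ℚ(y)`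
  have hf : f = PowerSeries.subst y (PowerSeries.map (Int.castRingHom ℚ) G) := by
    rw [← hfG, subst_comp_subst_apply hxs hys, hxy, X_subst]
  -- `y(M X) = M v_ℚ`
  have hyM : (PowerSeries.subst ((M : ℚ) • (X : PowerSeries ℚ)) y : PowerSeries ℚ) = (M : ℚ) • vq := by
    rw [hy, PowerSeries.subst_smul hMX, subst_comp_subst_apply hXM hMX, hXMdef, smul_X_subst _ hMX,
      smul_smul, inv_mul_cancel₀ hMq, one_smul, X_subst]
  have hmapMv : PowerSeries.map (Int.castRingHom ℚ) (C (M : ℤ) * v) = (M : ℚ) • vq := by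
    rw [map_mul, map_C, smul_eq_C_mul]
    simp [hvq]
  refine ⟨PowerSeries.subst (C (M : ℤ) * v) G, ?_⟩
  rw [rescale_eq_subst, hf, subst_comp_subst_apply hys hMX, hyM, map_subst' hMv, hmapMv]

end Literature.RingTheory.PowerSeries
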